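import Summits.BirchSwinnertonDyer.BirchSwinnertonDyer.Theorems.BiquadraticEisensteinDescentDeuringOfCore
import Summits.BirchSwinnertonDyer.BirchSwinnertonDyer.Theorems.BiquadraticEisensteinDescentDeuringCoreRow
import Literature.NumberTheory.EllipticCurves.JZeroKolyvaginPrimes
import Literature.NumberTheory.EllipticCurves.DeuringHeckeContinuationFiveRows
import Literature.NumberTheory.EllipticCurves.ComplexMultiplicationShaRubinRationalCMProofs
import Literature.NumberTheory.EllipticCurves.LFunctionSmulProofs
import HarnessLib

set_option autoImplicit false

/-!
# BED route, «Deuring-ψ lane»: the row `j = 0` of `Deuring_exists_heckeCharacter_of_maximalCM` REDUCED to the CORE of the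
# sextic twists `y² = x³ + k` (`k ∈ ℤ` sixth-power-free) over `ℚ(ζ₃)`

Route `BiquadraticEisensteinDescent` of `Summits/BirchSwinnertonDyer` (crux `EisensteinHeartFlatCMInertBadKPrime`,
stmt-BirchSwinnertonDyer-21341; cell `bsd-wall`, seat w4 g18). THEOREMS ONLY.  The `j = 0` twin of
`…DeuringRowSeventeenTwentyEight` (`j = 1728`), written MODULO the Mordell CORE, which is the datum lane of seat w1
(`GaloisRepresentations/EisensteinSextic*`, the Größencharakter `𝔭 ↦ (k/N𝔭)(4k/𝔭)₃ ϖ_𝔭` of Ireland–Rosen Ch. 18 §7):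

* `isCyclotomicExtension_three_of_isCMFieldOfJ_zero` — a CM field of `j = 0` (`[K:ℚ] = 2`, `θ² = −3 = cmFieldDiscr 0`) IS `ℚ(ζ₃)`
  (`ω = (θ − 1)/2`, `JZero.isCyclotomicExtension_three_of_sq_add_self_add_one`); `discr_of_isCMFieldOfJ_zero` (`d_K = −3`);
* `core_of_j_eq_0_of_mordellCore` — for every elliptic `W/ℚ` with `W.j = 0` and every `K` with `IsCMFieldOfJ K W.j`: IF every sextic
  twist `y² = x³ + k` (`k ≠ 0` sixth-power-free) has a Hecke character of `K` of type `(1, 0)` with `L(s, ψ) = L(y² = x³ + k, s)` on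
  `re s > 3/2` (the Mordell CORE over `K`), THEN so does `W`: `W ≅ y² = x³ + B` (`Rubin1987.exists_smul_eq_of_j_eq_zero`), `B = k q⁶`
  with `k ∈ ℤ` sixth-power-free (`DeuringHecke.rat_exists_eq_intCast_mul_pow 6`), `y² = x³ + k q⁶ ≅ y² = x³ + k`
  (`DeuringHecke.smul_sextic_model`), and `L`-series are isomorphism invariants (`LSeries_smul`, `core_of_LSeries_eq`);
* ★ `deuring_of_j_eq_0_of_mordellCore` — all five clauses of `Deuring_exists_heckeCharacter_of_maximalCM` for every globally minimal
  `W` with `j(W) = 0`, every CM field `K` of `W`, every `c ≠ 1`, MODULO the Mordell CORE over `K` (`deuring_of_core_at`).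

BSD is not proved by any of this; the row `j = 0` itself still waits on the Mordell CORE (seat w1's datum through `core_of_datum_set`).
References: [IrelandRosen1990] Ch. 18 §7; [SilvermanATAEC1994] II Thm. 9.2, Thm. 10.5 (b), Ex. 2.30–2.32; [SilvermanAEC2009] X.5 Prop. 5.4.
-/

set_option linter.dupNamespace false -- `Summit.BirchSwinnertonDyer.BirchSwinnertonDyer.Theorems.…` (summit = sub)

noncomputable section

namespace Summit.BirchSwinnertonDyer.BirchSwinnertonDyer.Theorems.BiquadraticEisensteinDescentDeuringOfCore

open scoped NumberField
open NumberField IsDedekindDomain WeierstrassCurve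
  Literature.NumberTheory.GaloisRepresentations Literature.NumberTheory.EllipticCurves

/-! ### The CM field of `j = 0` is `ℚ(ζ₃)` -/

/-- **A quadratic field containing `√−3` is `ℚ(ζ₃)`**: if `[K : ℚ] = 2` and `θ² = −3` in `K` then `ω = (θ − 1)/2` satisfies
`ω² + ω + 1 = 0`, so `K = ℚ(ω)` is the third cyclotomic field (`JZero.isCyclotomicExtension_three_of_sq_add_self_add_one`).
[cite: IrelandRosen1990, Ch. 13 §1 (quadratic number fields); Ch. 9 §1 (ℤ[ω])] -/
theorem isCyclotomicExtension_three_of_sq_eq_neg_three {K : Type} [Field K] [NumberField K]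
    (h2 : Module.finrank ℚ K = 2) {θ : K} (hθ : θ ^ 2 = -3) : IsCyclotomicExtension {3} ℚ K :=
  JZero.isCyclotomicExtension_three_of_sq_add_self_add_one (ω := (θ - 1) / 2)
    (by linear_combination (1 / 4 : K) * hθ) h2

/-- **The CM field of `j = 0` is `ℚ(ζ₃)`**: `IsCMFieldOfJ K 0` (`[K : ℚ] = 2`, `θ² = cmFieldDiscr 0 = −3`) gives
`IsCyclotomicExtension {3} ℚ K`. [cite: SilvermanATAEC1994, App. A §3 (first table: j = 0, d_K = −3)] -/
theorem isCyclotomicExtension_three_of_isCMFieldOfJ_zero {K : Type} [Field K] [NumberField K]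
    (hK : IsCMFieldOfJ K 0) : IsCyclotomicExtension {3} ℚ K := by
  obtain ⟨θ, hθ⟩ := hK.2
  have hθ' : θ ^ 2 = -3 := by rw [hθ]; norm_num [cmFieldDiscr]
  exact isCyclotomicExtension_three_of_sq_eq_neg_three hK.1 hθ'

/-- **`d_K = −3` for a CM field of `j = 0`** (`JZero.discr_eq_neg_three_of_sq_add_self_add_one`). [cite: SilvermanATAEC1994, App. A §3 (first table: j = 0, d_K = −3)] -/
theorem discr_of_isCMFieldOfJ_zero {K : Type} [Field K] [NumberField K] (hK : IsCMFieldOfJ K 0) :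
    NumberField.discr K = -3 := by
  obtain ⟨θ, hθ⟩ := hK.2
  have hθ' : θ ^ 2 = -3 := by rw [hθ]; norm_num [cmFieldDiscr]
  exact JZero.discr_eq_neg_three_of_sq_add_self_add_one (ω := (θ - 1) / 2)
    (by linear_combination (1 / 4 : K) * hθ') hK.1

/-! ### The row `j = 0` modulo the Mordell CORE -/

/-- **The CORE of Deuring's theorem for EVERY elliptic curve over `ℚ` with `j = 0`, modulo the CORE of the sextic twists.**
Let `K` be a CM field of `W.j = 0` (`= ℚ(ζ₃)`) and suppose that for every `k ∈ ℤ`, `k ≠ 0` free of sixth powers of primes, there is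
a Hecke character of `K` of infinity type `(1, 0)` with `L(s, ψ) = L(y² = x³ + k, s)` on `re s > 3/2`. Then the same holds for `W`:
`W ≅ y² = x³ + B` (`Rubin1987.exists_smul_eq_of_j_eq_zero`), `B = k q⁶` with `k ∈ ℤ` sixth-power-free
(`DeuringHecke.rat_exists_eq_intCast_mul_pow`), `y² = x³ + k q⁶ ≅ y² = x³ + k` (`DeuringHecke.smul_sextic_model`), and `L`-series are
isomorphism invariants (`LSeries_smul`). [cite: SilvermanAEC2009, X.5 Prop. 5.4 (ii), (iii)] [cite: SilvermanATAEC1994, Ch. II Thm. 9.2 (a), Thm. 10.5 (b)] -/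
theorem core_of_j_eq_0_of_mordellCore (W : WeierstrassCurve ℚ) [W.IsElliptic] (hjW : W.j = 0)
    (K : Type) [Field K] [NumberField K]
    (hM : ∀ k : ℤ, k ≠ 0 → (∀ p : ℕ, p.Prime → ¬ (p : ℤ) ^ 6 ∣ k) →
      ∃ ψ : HeckeCharacter K, ψ.HasInfinityType (fun _ => 1) (fun _ => 0) ∧
        ∀ s : ℂ, 3 / 2 < s.re → heckeLFunction ψ s = (⟨0, 0, 0, 0, (k : ℚ)⟩ : WeierstrassCurve ℚ).LSeries s) :
    ∃ ψ : HeckeCharacter K, ψ.HasInfinityType (fun _ => 1) (fun _ => 0) ∧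
      ∀ s : ℂ, 3 / 2 < s.re → heckeLFunction ψ s = W.LSeries s := by
  -- `W ≅ y² = x³ + B ≅ y² = x³ + k`, `k` sixth-power-free
  obtain ⟨B, C, hB, hC⟩ := Rubin1987.exists_smul_eq_of_j_eq_zero hjW
  obtain ⟨k, q, hk, hq, hBeq, hfree⟩ := DeuringHecke.rat_exists_eq_intCast_mul_pow 6 (by norm_num) B hB
  have hcore := hM k hk hfree
  -- `L(W, s) = L(y² = x³ + k, s)`
  haveI hE1 : (C • W).IsElliptic := by infer_instance
  haveI hE2 : ((⟨0, 0, 0, 0, (k : ℚ) * q ^ 6⟩ : WeierstrassCurve ℚ)).IsElliptic := by rw [← hBeq, ← hC]; exact hE1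
  have hL : W.LSeries = ((⟨0, 0, 0, 0, (k : ℚ)⟩ : WeierstrassCurve ℚ)).LSeries := by
    rw [← DeuringHecke.smul_sextic_model (B := (k : ℚ)) hq, WeierstrassCurve.LSeries_smul, ← hBeq, ← hC,
      WeierstrassCurve.LSeries_smul]
  exact core_of_LSeries_eq hL hcore

/-- ★ **Deuring's theorem (all five clauses of `Deuring_exists_heckeCharacter_of_maximalCM`) for every globally minimal `W/ℚ` with
`j(W) = 0`, MODULO the CORE of the sextic twists over the CM field `K`** (`core_of_j_eq_0_of_mordellCore` + `deuring_of_core_at`):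
CM by `ℤ[ζ₃]`, the family `y² = x³ + k`. [cite: IrelandRosen1990, Ch. 18 §7] [cite: SilvermanATAEC1994, Ch. II Thm. 9.2, Cor. 10.4.1, Thm. 10.5 (b), Ex. 2.30–2.32] -/
theorem deuring_of_j_eq_0_of_mordellCore (W : WeierstrassCurve ℚ) [W.IsElliptic] [W.IsGloballyMinimal] (hjW : W.j = 0)
    (K : Type) [Field K] [NumberField K] (hK : IsCMFieldOfJ K W.j)
    (hM : ∀ k : ℤ, k ≠ 0 → (∀ p : ℕ, p.Prime → ¬ (p : ℤ) ^ 6 ∣ k) →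
      ∃ ψ : HeckeCharacter K, ψ.HasInfinityType (fun _ => 1) (fun _ => 0) ∧
        ∀ s : ℂ, 3 / 2 < s.re → heckeLFunction ψ s = (⟨0, 0, 0, 0, (k : ℚ)⟩ : WeierstrassCurve ℚ).LSeries s)
    (c : K ≃ₐ[ℚ] K) (hc : c ≠ 1) :
    ∃ ψ : HeckeCharacter K,
      ψ.HasInfinityType (fun _ ↦ 1) (fun _ ↦ 0) ∧
      IsHeckeConjEquivariant c ψ ∧
      (∀ w : HeightOneSpectrum (𝓞 K), ψ.IsUnramifiedAt w ↔ (W.baseChange K).HasGoodReductionAt w) ∧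
      (∀ (p : ℕ) [Fact p.Prime], W.HasGoodReductionAtPrime p →
        ∀ w : HeightOneSpectrum (𝓞 K), (p : 𝓞 K) ∈ w.asIdeal →
          ψ.IsUnramifiedAt w ∧
          (c • w ≠ w →
            ψ.valueAtUniformizer w + ψ.valueAtUniformizer (c • w) = (W.frobeniusTrace p : ℂ) ∧
            ψ.valueAtUniformizer w * ψ.valueAtUniformizer (c • w) = (p : ℂ)) ∧
          (c • w = w → W.frobeniusTrace p = 0 ∧ ψ.valueAtUniformizer w = -(p : ℂ))) ∧
      ∀ s : ℂ, 3 / 2 < s.re → heckeLFunction ψ s = W.LSeries s :=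
  deuring_of_core_at W (by rw [hjW]; simp [maximalCMJInvariants]) K hK c hc (core_of_j_eq_0_of_mordellCore W hjW K hM)

end Summit.BirchSwinnertonDyer.BirchSwinnertonDyer.Theorems.BiquadraticEisensteinDescentDeuringOfCore

end
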